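import Summits.CriticalPhenomena.Ising3DConformalLimit.Theses.FKParityRobustness
import Summits.CriticalPhenomena.Ising3DConformalLimit.Theorems.FKParityRobustnessParityBoundCurrents
import Literature.Probability.LatticeModels.WeightedCurrents

/-!
# `StrandsJoinBound` — two independent high-temperature strands that join force `U₄ < 0`

Item stmt-CriticalPhenomena-14647 `StrandsJoinBound` (support) of route `FKParityRobustness`,
sub-problem `Ising3DConformalLimit`.

**Statement.** On every finite graph `G`, for `β ≥ 0`, an injective `a : Fin 4 → V` and `t = tanh β`,
`U₄^free(a) · Z⁰_t(G)² ≤ −2 · Σ_{F₁ ∈ 𝒯(a₀a₁)} Σ_{F₂ ∈ 𝒯(a₂a₃)} t^{|F₁|+|F₂|} 1[a₀ ↔ a₂ in F₁ ∪ F₂]`,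
where `𝒯(A)` (`tJoins G univ A`) is the set of edge sets with odd-degree set `A` and `Z⁰_t` is the
sourceless loop-O(1) partition function.

**Proof.** (1) Aizenman's `U₄` identity in the additive `ℝ≥0∞` product form
(`Current.ursellFour_currentSum_identity`):
`Z[D]Z[∅] + 2·Σ 1{∂n₁ = a₀a₁} 1{∂n₂ = a₂a₃} w w 1[a₂ ∈ C_{n₁+n₂}(a₀)] = Z[a₀a₁]Z[a₂a₃] + Z[a₀a₂]Z[a₁a₃] + Z[a₀a₃]Z[a₁a₂]`.
(2) `odd(n₁) ∪ odd(n₂) ⊆ trace(n₁ + n₂)`, so joining inside the two odd parts implies joining in the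
double current (`ite_reachable_oddPart_le`). (3) The two-copy odd-part pushforward
(`twoCopyPushforward`): under `1{∂n = A} w_β` the odd part is distributed as
`sinh(β)^{|F|} cosh(β)^{|E|−|F|}` on `𝒯(A)` (the landed one-copy lemma
`tsum_sources_eweight_mul_apply_oddPart`, applied to each copy), and
`sinh^k cosh^{|E|−k} = cosh^{|E|} tanh^k`. (4) Cast to `ℝ` and divide by
`Z[∅]² = cosh(β)^{2|E|} · (Z⁰_t)²`, using `⟨σ_A⟩^free = Z[A]/Z[∅]`
(`isingExpect_spinMonomial_four_eq`, `isingTwoPoint_free_eq_currentSum_div_holds`).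

Adapted (Card 1 only, definitions inlined) from the crux-ideation planner's kernel-checked candidate
`Cruxes/JoinForcesU4/CandidateProof_JoinForcesU4.lean` attached to this item.

## References

* M. Aizenman, *Geometric analysis of φ⁴ fields and Ising models*, Comm. Math. Phys. 86 (1982),
  Prop. 5.3 [AizenmanCMP1982].
* M. Aizenman, H. Duminil-Copin, Ann. of Math. 194 (2021), eq. (3.11) [AizenmanDuminilCopinAnnals2021].
* H. Duminil-Copin, *Random currents expansion of the Ising model*, arXiv:1607.06933, Remark 3.4
  [DuminilCopin2016].
-/

namespace Summit.CriticalPhenomena.Ising3DConformalLimit.FKParityRobustnessStrandsJoinBound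

open scoped BigOperators symmDiff ENNReal
open Finset Literature.Probability.LatticeModels
open Summit.CriticalPhenomena.Ising3DConformalLimit.Theses.FKParityRobustness
open scoped Classical

/-- `odd(n₁) ∪ odd(n₂) ⊆ trace(n₁ + n₂)`, so joining `a₀ ↔ a₂` inside the union of the two odd parts
implies `a₂ ∈ C_{n₁+n₂}(a₀)` in the double current; indicator form in `ℝ≥0∞`
(from `coe_oddPart_subset_traced_add`). [folklore] -/
theorem ite_reachable_oddPart_le {V : Type*} [Fintype V] [DecidableEq V] {G : SimpleGraph V}
    [DecidableRel G.Adj] (a : Fin 4 → V) (p : Current G × Current G) :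
    (if (SimpleGraph.fromEdgeSet
          ((↑((univ.filter fun e : G.edgeFinset => Odd (p.1 e)).map
              (Function.Embedding.subtype _)) : Set (Sym2 V)) ∪
            ↑((univ.filter fun e : G.edgeFinset => Odd (p.2 e)).map
              (Function.Embedding.subtype _)))).Reachable (a 0) (a 2)
        then (1 : ℝ≥0∞) else 0) ≤
      (if a 2 ∈ (p.1 + p.2).cluster (a 0) then 1 else 0) := by
  by_cases h : (SimpleGraph.fromEdgeSet
          ((↑((univ.filter fun e : G.edgeFinset => Odd (p.1 e)).map
              (Function.Embedding.subtype _)) : Set (Sym2 V)) ∪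
            ↑((univ.filter fun e : G.edgeFinset => Odd (p.2 e)).map
              (Function.Embedding.subtype _)))).Reachable (a 0) (a 2)
  · have h2 : (↑((univ.filter fun e : G.edgeFinset => Odd (p.2 e)).map
        (Function.Embedding.subtype _)) : Set (Sym2 V)) ⊆ (p.1 + p.2).traced := by
      rw [add_comm]
      exact Summit.CriticalPhenomena.Ising3DConformalLimit.Theorems.coe_oddPart_subset_traced_add p.2 p.1
    have hle : SimpleGraph.fromEdgeSet
          ((↑((univ.filter fun e : G.edgeFinset => Odd (p.1 e)).map
              (Function.Embedding.subtype _)) : Set (Sym2 V)) ∪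
            ↑((univ.filter fun e : G.edgeFinset => Odd (p.2 e)).map
              (Function.Embedding.subtype _))) ≤
        Literature.Probability.Percolation.openGraph (p.1 + p.2).traced :=
      SimpleGraph.fromEdgeSet_mono (Set.union_subset
        (Summit.CriticalPhenomena.Ising3DConformalLimit.Theorems.coe_oddPart_subset_traced_add p.1 p.2) h2)
    rw [if_pos h, if_pos (Current.mem_cluster_iff.2 (h.mono hle))]
  · rw [if_neg h]
    exact bot_le

/-- `tJoins G univ A` is the powerset of `E(G)` filtered by the odd-degree (source) condition alone.
[folklore] -/
theorem tJoins_univ_eq_filter {V : Type*} [Fintype V] [DecidableEq V] (G : SimpleGraph V)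
    [DecidableRel G.Adj] (A : Finset V) :
    tJoins G Set.univ A =
      G.edgeFinset.powerset.filter (fun F => ∀ v, Odd #(F.filter (v ∈ ·)) ↔ v ∈ A) := by
  unfold tJoins
  exact Finset.filter_congr fun F _ => by simp only [Set.subset_univ, true_and]

/-- **Two-copy odd-part pushforward identity** (`ℝ≥0∞`): pushing the pair
`(n₁, n₂) ~ 1{∂n₁ = a₀a₁}1{∂n₂ = a₂a₃} w_β w_β` forward along `(odd n₁, odd n₂)` turns the indicator
of `a₀ ↔ a₂ in odd(n₁) ∪ odd(n₂)` into `cosh(β)^{2|E|}` times the joint loop-O(1) sum at `t = tanh β`.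
Proof: `epairWeight_eq_mul` + `ENNReal.tsum_prod'` + `ENNReal.tsum_mul_left` + twice the one-copy
lemma `tsum_sources_eweight_mul_apply_oddPart`, then `sinh^k cosh^{|E|-k} = cosh^{|E|} tanh^k`
termwise. [cite: DuminilCopin2016, Remark 3.4] -/
theorem twoCopyPushforward {V : Type*} [Fintype V] [DecidableEq V] (G : SimpleGraph V)
    [DecidableRel G.Adj] {β : ℝ} (hβ : 0 ≤ β) (a : Fin 4 → V) (ha : Function.Injective a) :
    ∑' p : Current G × Current G,
        epairWeight (fun _ : G.edgeFinset => β) ({a 0} ∆ {a 1}) ({a 2} ∆ {a 3}) p *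
          (if (SimpleGraph.fromEdgeSet
              ((↑((univ.filter fun e : G.edgeFinset => Odd (p.1 e)).map
                  (Function.Embedding.subtype _)) : Set (Sym2 V)) ∪
                ↑((univ.filter fun e : G.edgeFinset => Odd (p.2 e)).map
                  (Function.Embedding.subtype _)))).Reachable (a 0) (a 2)
            then 1 else 0) =
      ENNReal.ofReal (Real.cosh β ^ (2 * #G.edgeFinset) *
        ∑ F₁ ∈ tJoins G Set.univ {a 0, a 1}, ∑ F₂ ∈ tJoins G Set.univ {a 2, a 3},
          if (SimpleGraph.fromEdgeSet ((↑F₁ : Set (Sym2 V)) ∪ ↑F₂)).Reachable (a 0) (a 2)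
            then Real.tanh β ^ (#F₁ + #F₂) else 0) := by
  -- notation
  set gI : Finset (Sym2 V) → Finset (Sym2 V) → ℝ≥0∞ := fun F₁ F₂ =>
    if (SimpleGraph.fromEdgeSet ((↑F₁ : Set (Sym2 V)) ∪ ↑F₂)).Reachable (a 0) (a 2) then 1 else 0
    with hgI
  set oddP : Current G → Finset (Sym2 V) := fun n =>
    (univ.filter fun e : G.edgeFinset => Odd (n e)).map (Function.Embedding.subtype _) with hoddP
  set sc : Finset (Sym2 V) → ℝ≥0∞ := fun F =>
    ENNReal.ofReal (Real.sinh β ^ #F * Real.cosh β ^ (#G.edgeFinset - #F)) with hsc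
  have h01 : ({a 0} : Finset V) ∆ {a 1} = {a 0, a 1} :=
    Current.symmDiff_singleton_eq_pair (ha.ne (by decide))
  have h23 : ({a 2} : Finset V) ∆ {a 3} = {a 2, a 3} :=
    Current.symmDiff_singleton_eq_pair (ha.ne (by decide))
  rw [h01, h23]
  -- the test function of the outer pushforward
  set H : Finset (Sym2 V) → ℝ≥0∞ := fun F₁ =>
    ∑ F₂ ∈ G.edgeFinset.powerset,
      if (∀ v, Odd #(F₂.filter (v ∈ ·)) ↔ v ∈ ({a 2, a 3} : Finset V)) then sc F₂ * gI F₁ F₂ else 0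
    with hH
  -- Step 1: iterate the tsum and factor the first weight out of the inner sum
  have step1 : (∑' p : Current G × Current G,
        epairWeight (fun _ : G.edgeFinset => β) {a 0, a 1} {a 2, a 3} p * gI (oddP p.1) (oddP p.2)) =
      ∑' n₁ : Current G, (if n₁.sources = {a 0, a 1} then n₁.eweight (fun _ : G.edgeFinset => β) else 0) *
        ∑' n₂ : Current G, (if n₂.sources = {a 2, a 3} then n₂.eweight (fun _ : G.edgeFinset => β) else 0) *
          gI (oddP n₁) (oddP n₂) := by
    rw [ENNReal.tsum_prod']
    refine tsum_congr fun n₁ => ?_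
    rw [← ENNReal.tsum_mul_left]
    refine tsum_congr fun n₂ => ?_
    rw [epairWeight_eq_mul, mul_assoc]
  -- Step 2: inner pushforward (one copy), for each fixed `n₁`
  have step2 : ∀ n₁ : Current G,
      (∑' n₂ : Current G, (if n₂.sources = {a 2, a 3} then n₂.eweight (fun _ : G.edgeFinset => β) else 0) *
          gI (oddP n₁) (oddP n₂)) = H (oddP n₁) := fun n₁ =>
    Summit.CriticalPhenomena.Ising3DConformalLimit.Theorems.tsum_sources_eweight_mul_apply_oddPart
      hβ {a 2, a 3} (gI (oddP n₁))
  -- Step 3: outer pushforward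
  have step3 : (∑' n₁ : Current G, (if n₁.sources = {a 0, a 1} then n₁.eweight (fun _ : G.edgeFinset => β) else 0) *
        H (oddP n₁)) =
      ∑ F₁ ∈ G.edgeFinset.powerset,
        if (∀ v, Odd #(F₁.filter (v ∈ ·)) ↔ v ∈ ({a 0, a 1} : Finset V)) then sc F₁ * H F₁ else 0 :=
    Summit.CriticalPhenomena.Ising3DConformalLimit.Theorems.tsum_sources_eweight_mul_apply_oddPart
      hβ {a 0, a 1} H
  -- assemble steps 1–3
  have lhs_eq : (∑' p : Current G × Current G,
        epairWeight (fun _ : G.edgeFinset => β) {a 0, a 1} {a 2, a 3} p * gI (oddP p.1) (oddP p.2)) =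
      ∑ F₁ ∈ G.edgeFinset.powerset,
        if (∀ v, Odd #(F₁.filter (v ∈ ·)) ↔ v ∈ ({a 0, a 1} : Finset V)) then sc F₁ * H F₁ else 0 := by
    rw [step1, ← step3]
    exact tsum_congr fun n₁ => by rw [step2 n₁]
  show (∑' p : Current G × Current G,
        epairWeight (fun _ : G.edgeFinset => β) {a 0, a 1} {a 2, a 3} p * gI (oddP p.1) (oddP p.2)) = _
  rw [lhs_eq]
  -- Step 4: identify the finite double sum with `cosh^{2|E|} ·` the joint loop-O(1) sum
  have ht : 0 ≤ Real.tanh β := by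
    rw [Real.tanh_eq_sinh_div_cosh]
    exact div_nonneg (Real.sinh_nonneg_iff.2 hβ) (Real.cosh_pos β).le
  have hterm_nonneg : ∀ F₁ F₂ : Finset (Sym2 V), 0 ≤ Real.cosh β ^ (2 * #G.edgeFinset) *
      (if (SimpleGraph.fromEdgeSet ((↑F₁ : Set (Sym2 V)) ∪ ↑F₂)).Reachable (a 0) (a 2)
        then Real.tanh β ^ (#F₁ + #F₂) else 0) := by
    intro F₁ F₂
    refine mul_nonneg (pow_nonneg (Real.cosh_pos β).le _) ?_
    split_ifs
    · exact pow_nonneg ht _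
    · exact le_rfl
  have hR : ENNReal.ofReal (Real.cosh β ^ (2 * #G.edgeFinset) *
        ∑ F₁ ∈ tJoins G Set.univ {a 0, a 1}, ∑ F₂ ∈ tJoins G Set.univ {a 2, a 3},
          if (SimpleGraph.fromEdgeSet ((↑F₁ : Set (Sym2 V)) ∪ ↑F₂)).Reachable (a 0) (a 2)
            then Real.tanh β ^ (#F₁ + #F₂) else 0) =
      ∑ F₁ ∈ tJoins G Set.univ {a 0, a 1}, ∑ F₂ ∈ tJoins G Set.univ {a 2, a 3},
        ENNReal.ofReal (Real.cosh β ^ (2 * #G.edgeFinset) *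
          (if (SimpleGraph.fromEdgeSet ((↑F₁ : Set (Sym2 V)) ∪ ↑F₂)).Reachable (a 0) (a 2)
            then Real.tanh β ^ (#F₁ + #F₂) else 0)) := by
    rw [Finset.mul_sum]
    rw [ENNReal.ofReal_sum_of_nonneg (fun F₁ _ => by
      rw [Finset.mul_sum]; exact Finset.sum_nonneg fun F₂ _ => hterm_nonneg F₁ F₂)]
    refine Finset.sum_congr rfl fun F₁ _ => ?_
    rw [Finset.mul_sum, ENNReal.ofReal_sum_of_nonneg (fun F₂ _ => hterm_nonneg F₁ F₂)]
  rw [hR, ← Finset.sum_filter, ← tJoins_univ_eq_filter G {a 0, a 1}]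
  have hH' : ∀ F₁, H F₁ = ∑ F₂ ∈ tJoins G Set.univ {a 2, a 3}, sc F₂ * gI F₁ F₂ := by
    intro F₁
    rw [hH, tJoins_univ_eq_filter G {a 2, a 3}, Finset.sum_filter]
  simp_rw [hH']
  refine Finset.sum_congr rfl fun F₁ hF₁ => ?_
  rw [Finset.mul_sum]
  refine Finset.sum_congr rfl fun F₂ hF₂ => ?_
  have hk₁ : #F₁ ≤ #G.edgeFinset := Finset.card_le_card ((mem_tJoins G).1 hF₁).1
  have hk₂ : #F₂ ≤ #G.edgeFinset := Finset.card_le_card ((mem_tJoins G).1 hF₂).1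
  simp only [hsc, hgI]
  rw [Summit.CriticalPhenomena.Ising3DConformalLimit.Theorems.sinh_pow_mul_cosh_pow_sub β hk₁,
    Summit.CriticalPhenomena.Ising3DConformalLimit.Theorems.sinh_pow_mul_cosh_pow_sub β hk₂]
  have hc : 0 ≤ Real.cosh β ^ #G.edgeFinset := pow_nonneg (Real.cosh_pos β).le _
  by_cases hRch : (SimpleGraph.fromEdgeSet ((↑F₁ : Set (Sym2 V)) ∪ ↑F₂)).Reachable (a 0) (a 2)
  · rw [if_pos hRch, if_pos hRch, mul_one,
      ← ENNReal.ofReal_mul (mul_nonneg hc (pow_nonneg ht _))]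
    congr 1
    ring
  · rw [if_neg hRch, if_neg hRch, mul_zero, mul_zero, mul_zero, ENNReal.ofReal_zero]


/-- **Two-copy parity bound** in the additive `ℝ≥0∞` product form of
`Current.ursellFour_currentSum_identity`:
`Z[D]·Z[∅] + 2·cosh(β)^{2|E|}·(joint sum) ≤ Z[a₀a₁]Z[a₂a₃] + Z[a₀a₂]Z[a₁a₃] + Z[a₀a₃]Z[a₁a₂]`,
from `twoCopyPushforward` and `odd(nᵢ) ⊆ trace(n₁+n₂)` (`ite_reachable_oddPart_le`).
[cite: AizenmanCMP1982, Prop. 5.3] -/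
theorem twoCopyOddPartBound {V : Type*} [Fintype V] [DecidableEq V] (G : SimpleGraph V)
    [DecidableRel G.Adj] {β : ℝ} (hβ : 0 ≤ β) (a : Fin 4 → V) (ha : Function.Injective a) :
    ecurrentSum (fun _ : G.edgeFinset => β) ({a 0} ∆ ({a 1} ∆ ({a 2} ∆ {a 3}))) *
        ecurrentSum (fun _ : G.edgeFinset => β) ∅ +
      2 * ENNReal.ofReal (Real.cosh β ^ (2 * #G.edgeFinset) *
        ∑ F₁ ∈ tJoins G Set.univ {a 0, a 1}, ∑ F₂ ∈ tJoins G Set.univ {a 2, a 3},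
          if (SimpleGraph.fromEdgeSet ((↑F₁ : Set (Sym2 V)) ∪ ↑F₂)).Reachable (a 0) (a 2)
            then Real.tanh β ^ (#F₁ + #F₂) else 0) ≤
    ecurrentSum (fun _ : G.edgeFinset => β) ({a 0} ∆ {a 1}) *
        ecurrentSum (fun _ : G.edgeFinset => β) ({a 2} ∆ {a 3}) +
      ecurrentSum (fun _ : G.edgeFinset => β) ({a 0} ∆ {a 2}) *
        ecurrentSum (fun _ : G.edgeFinset => β) ({a 1} ∆ {a 3}) +
      ecurrentSum (fun _ : G.edgeFinset => β) ({a 0} ∆ {a 3}) *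
        ecurrentSum (fun _ : G.edgeFinset => β) ({a 1} ∆ {a 2}) := by
  have hK : ∀ _e : G.edgeFinset, 0 ≤ β := fun _ => hβ
  rw [Current.ursellFour_currentSum_identity (K := fun _ => β) hK (a 0) (a 1) (a 2) (a 3),
    ← twoCopyPushforward G hβ a ha]
  refine add_le_add le_rfl (mul_le_mul' le_rfl ?_)
  exact ENNReal.tsum_le_tsum fun p => mul_le_mul' le_rfl (ite_reachable_oddPart_le a p)

/-- The sourceless loop-O(1) partition function `Z⁰_t(G)` is the sum of `t^{|F|}` over the even
subgraphs `F` of `G`. [folklore] -/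
theorem loopO1PartitionFunction_empty_eq {V : Type*} [Fintype V] [DecidableEq V] (G : SimpleGraph V)
    [DecidableRel G.Adj] (t : ℝ) :
    loopO1PartitionFunction G t ∅ = ∑ F ∈ evenSubgraphs G Set.univ, t ^ #F := by
  unfold loopO1PartitionFunction loopO1Weight evenSubgraphs
  rw [← Finset.sum_filter]
  congr 1
  rw [Finset.filter_mem_eq_inter, Finset.inter_eq_right]
  intro F hF
  exact Finset.mem_powerset.2 ((mem_tJoins G).1 hF).1

/-- **`StrandsJoinBound` (item stmt-CriticalPhenomena-14647) holds**: from `twoCopyOddPartBound` by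
casting to `ℝ` and dividing by `Z[∅]² = cosh(β)^{2|E|}·(Z⁰_{tanh β})²`
(`ecurrentSum_empty_eq_ofReal`, `ecurrentSum_eq_ofReal`, `isingExpect_spinMonomial_four_eq`,
`isingTwoPoint_free_eq_currentSum_div_holds`). [cite: AizenmanCMP1982, Prop. 5.3] -/
theorem strandsJoinBound_proof : StrandsJoinBound := by
  intro V _ _ G _ β hβ a ha
  set K : G.edgeFinset → ℝ := fun _ => β with hKdef
  have hK : ∀ e : G.edgeFinset, 0 ≤ K e := fun _ => hβ
  set z : Finset V → ℝ := fun A => wcurrentSum K A with hz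
  set D : Finset V := {a 0} ∆ ({a 1} ∆ ({a 2} ∆ {a 3})) with hD
  set cE : ℝ := Real.cosh β ^ #G.edgeFinset with hcE
  set Z0 : ℝ := loopO1PartitionFunction G (Real.tanh β) ∅ with hZ0
  set J : ℝ := (∑ F₁ ∈ tJoins G Set.univ {a 0, a 1}, ∑ F₂ ∈ tJoins G Set.univ {a 2, a 3},
    if (SimpleGraph.fromEdgeSet ((↑F₁ : Set (Sym2 V)) ∪ ↑F₂)).Reachable (a 0) (a 2)
      then Real.tanh β ^ (#F₁ + #F₂) else 0) with hJ
  have ht : 0 ≤ Real.tanh β := by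
    rw [Real.tanh_eq_sinh_div_cosh]
    exact div_nonneg (Real.sinh_nonneg_iff.2 hβ) (Real.cosh_pos β).le
  have hcE0 : 0 < cE := pow_pos (Real.cosh_pos β) _
  have hZ00 : 0 < Z0 := loopO1PartitionFunction_empty_pos G ht
  have hJ0 : 0 ≤ J := by
    refine Finset.sum_nonneg fun F₁ _ => Finset.sum_nonneg fun F₂ _ => ?_
    split_ifs
    · exact pow_nonneg ht _
    · exact le_rfl
  have hz_nonneg : ∀ A, 0 ≤ z A := fun A => wcurrentSum_nonneg hK A
  have hc2 : Real.cosh β ^ (2 * #G.edgeFinset) = cE ^ 2 := by rw [hcE, ← pow_mul']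
  -- `Z[∅] = cosh^{|E|} · Z⁰_t`
  have hz0 : z ∅ = cE * Z0 := by
    have h := Summit.CriticalPhenomena.Ising3DConformalLimit.Theorems.ecurrentSum_empty_eq_ofReal
      (G := G) hβ
    rw [ecurrentSum_eq_ofReal hK] at h
    have h' := congrArg ENNReal.toReal h
    rwa [ENNReal.toReal_ofReal (hz_nonneg ∅), ENNReal.toReal_ofReal
      (mul_nonneg hcE0.le (Finset.sum_nonneg fun F _ => pow_nonneg ht _)),
      ← loopO1PartitionFunction_empty_eq] at h'
  -- 1b cast to `ℝ`
  have h1b := twoCopyOddPartBound G hβ a ha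
  have eL : ecurrentSum K D * ecurrentSum K ∅ + 2 * ENNReal.ofReal (Real.cosh β ^ (2 * #G.edgeFinset) * J) =
      ENNReal.ofReal (z D * z ∅ + 2 * (cE ^ 2 * J)) := by
    have h2J : (0:ℝ) ≤ 2 * (cE ^ 2 * J) := mul_nonneg (by norm_num) (mul_nonneg (sq_nonneg _) hJ0)
    rw [ENNReal.ofReal_add (mul_nonneg (hz_nonneg D) (hz_nonneg ∅)) h2J,
      ENNReal.ofReal_mul (hz_nonneg D), ENNReal.ofReal_mul (by norm_num : (0:ℝ) ≤ 2),
      ENNReal.ofReal_ofNat, ecurrentSum_eq_ofReal hK, ecurrentSum_eq_ofReal hK, hc2]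
  have eR : ecurrentSum K ({a 0} ∆ {a 1}) * ecurrentSum K ({a 2} ∆ {a 3}) +
        ecurrentSum K ({a 0} ∆ {a 2}) * ecurrentSum K ({a 1} ∆ {a 3}) +
        ecurrentSum K ({a 0} ∆ {a 3}) * ecurrentSum K ({a 1} ∆ {a 2}) =
      ENNReal.ofReal (z ({a 0} ∆ {a 1}) * z ({a 2} ∆ {a 3}) + z ({a 0} ∆ {a 2}) * z ({a 1} ∆ {a 3}) +
        z ({a 0} ∆ {a 3}) * z ({a 1} ∆ {a 2})) := by
    have hp : ∀ A B : Finset V, 0 ≤ z A * z B := fun A B => mul_nonneg (hz_nonneg A) (hz_nonneg B)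
    rw [ENNReal.ofReal_add (add_nonneg (hp _ _) (hp _ _)) (hp _ _), ENNReal.ofReal_add (hp _ _) (hp _ _),
      ENNReal.ofReal_mul (hz_nonneg _), ENNReal.ofReal_mul (hz_nonneg _), ENNReal.ofReal_mul (hz_nonneg _)]
    simp only [hz, ecurrentSum_eq_ofReal hK]
  have h1bR : z D * z ∅ + 2 * (cE ^ 2 * J) ≤
      z ({a 0} ∆ {a 1}) * z ({a 2} ∆ {a 3}) + z ({a 0} ∆ {a 2}) * z ({a 1} ∆ {a 3}) +
        z ({a 0} ∆ {a 3}) * z ({a 1} ∆ {a 2}) := by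
    have hp : ∀ A B : Finset V, 0 ≤ z A * z B := fun A B => mul_nonneg (hz_nonneg A) (hz_nonneg B)
    have h := h1b
    rw [eL, eR, ENNReal.ofReal_le_ofReal_iff (add_nonneg (add_nonneg (hp _ _) (hp _ _)) (hp _ _))] at h
    exact h
  -- the correlators as current-sum ratios
  have h4 : nPoint (isingMeasure G Finset.univ β 0 .free) spinAt a = z D / z ∅ := by
    have hmono : spinMonomial a = spinMonomial ![a 0, a 1, a 2, a 3] := by
      congr 1; funext i; fin_cases i <;> rfl
    rw [nPoint_isingMeasure, hmono, isingExpect_spinMonomial_four_eq G β (a 0) (a 1) (a 2) (a 3)]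
    rfl
  have h2 : ∀ x y : V, twoPoint (isingMeasure G Finset.univ β 0 .free) spinAt x y = z ({x} ∆ {y}) / z ∅ := by
    intro x y
    rw [twoPoint_isingMeasure, isingTwoPoint_free_eq_currentSum_div_holds G β x y]
    rfl
  show connectedFour (isingMeasure G Finset.univ β 0 .free) spinAt a * Z0 ^ 2 ≤ -(2 * J)
  unfold connectedFour
  simp only [h4, h2, hz0]
  rw [hz0] at h1bR
  have key : (z D / (cE * Z0) - z ({a 0} ∆ {a 1}) / (cE * Z0) * (z ({a 2} ∆ {a 3}) / (cE * Z0)) -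
        z ({a 0} ∆ {a 2}) / (cE * Z0) * (z ({a 1} ∆ {a 3}) / (cE * Z0)) -
        z ({a 0} ∆ {a 3}) / (cE * Z0) * (z ({a 1} ∆ {a 2}) / (cE * Z0))) * Z0 ^ 2 =
      (z D * (cE * Z0) - (z ({a 0} ∆ {a 1}) * z ({a 2} ∆ {a 3}) + z ({a 0} ∆ {a 2}) * z ({a 1} ∆ {a 3}) +
        z ({a 0} ∆ {a 3}) * z ({a 1} ∆ {a 2}))) / cE ^ 2 := by
    field_simp
    ring
  rw [key, div_le_iff₀ (by positivity)]
  nlinarith [h1bR]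

end Summit.CriticalPhenomena.Ising3DConformalLimit.FKParityRobustnessStrandsJoinBound
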